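/-
Copyright (c) 2026. All rights reserved.
Released under Apache 2.0 license as described in the file LICENSE.
Authors: abc-iut cell, wave-W6 seat abc-iut-w6-d074 (row THM26-SIGMA-SWEEP, abc-iut-L4-lead RULING #6r).
-/
import Literature.AnabelianGeometry.AbsoluteAnabelian.AbsTopIThm26iPreservesGeomProofs
import Literature.AnabelianGeometry.AbsoluteAnabelian.AbsTopIThm26iProSigmaProofs
import HarnessLib

/-!
# [AbsTopI] Thm 2.6 (i), clause level and "`Δ ⊆ Π` is group-theoretic", with the PRINTED input shape:
# `Δ` pro-`Σ`, "`T_l(A)/G = 0`" for `l ∈ Σ` only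

S. Mochizuki, *Topics in Absolute Anabelian Geometry I: Generalities* (2012) [AbsTopI], Thm 2.6 (i),
manuscript p. 21 (lit key `paper:url-11ac98ba15fc`), proof p. 22 l. 33 – p. 23 l. 7: "the morphism
`X → A` induces an isomorphism `Δ^{ab-t} ⊗ ℤ_l ⥲ T_l(A)` […] for all `l ∈ Σ`. […] The remainder of
assertion (i) follows immediately from the fact that `T_l(A)/G = 0`".

PROOF-ONLY companion (no definition, no named fact, no `sorry`) — third file of the THM26-SIGMA-SWEEP
after `AbsTopIThm26viProSigmaProofs.lean` ((vi), `NFBase.thm26vi_of_isProSet`) and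
`AbsTopIThm26iProSigmaProofs.lean` ((i), `thm26i_of_isFreeProcyclic_of_isProSet`).  The sweep over the
tree's [AbsTopI] Thm 2.6 closers found these remaining theorems whose Tate-module / character hypothesis
is asked at EVERY prime `l` where print supplies it for `l ∈ Σ` only (`Δ` being the maximal pro-`Σ`
quotient of the geometric fundamental group):

* abc-iut-L4-t4's CLAUSE theorems of `AbsTopIThm26iProofs.lean` —
  `freeProlRank_eq_aug_map_of_invariantCharacters_trivial` ("`T_l(A)/G = 0` ⇒ `δ¹_l(H) = δ¹_l(G_H)`"),
  `geom_eq_iInf_ker_of_isFreeProcyclic` ("`Ker(Π ↠ G) = Ker(Π ↠ Π^{ab-t})`"),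
  `freeProlRank_open_eq_one_of_isFreeProcyclic` ("`δ¹_l(H) = 1`");
* abc-iut-L4-t4's USE theorem `preservesGeom_of_isFreeProcyclic` of `AbsTopIThm26iPreservesGeomProofs.lean`
  (isomorphisms `Π₁ ⥲ Π₂` carry `Δ₁` onto `Δ₂`, the form in which [AbsTopI] Thm 2.14 (i) and
  [IUTchI–II] "`Δ ⊆ Π` may be reconstructed group-theoretically" consume Thm 2.6).

Here each gets its printed-shape form, consuming BY NAME the sweep's bricks
`IsProSet.apply_padicInt_eq_one` (w6-d074, (vi) file), `FundamentalExtension.isProSet_geom_inf_of_isOpen`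
(w6-d074, (i) file) and abc-iut-L4-t4's clause theorems:

* `FundamentalExtension.invariantCharactersOpen_trivial_of_isProSet` — the reusable BRIDGE in the
  (i)-shape (open subgroups `H ⊆ Π`, characters of `Δ ∩ H`): for `Δ` pro-`Σ`, the all-primes hypothesis
  follows from its restriction to `l ∈ Σ` (for `l ∉ Σ`, `Δ ∩ H` is pro-`Σ` and has no non-trivial
  continuous character to `ℤ_l`, invariant or not);
* `FundamentalExtension.freeProlRank_eq_aug_map_of_isProSet` — **hypothesis-free off `Σ`**: for `Δ`
  pro-`Σ`, `l ∉ Σ` and EVERY open `H ⊆ Π`, `δ¹_l(H) = δ¹_l(G_H)` (abc-iut-L4-t4's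
  `freeProlRank_arith_eq_gal_of_isProSet` of the (ii) companion is the case `H = Π`);
* `FundamentalExtension.freeProlRank_open_eq_one_of_isFreeProcyclic_of_not_mem` — for `G ≅ Ẑ`, `Δ`
  pro-`Σ`, `l ∉ Σ`: `δ¹_l(H) = 1` for every open `H`, with NO Tate-module input;
* `FundamentalExtension.geom_eq_iInf_ker_of_isFreeProcyclic_of_isProSet` — the characterization clause
  "`Δ = ⋂_l ⋂_{φ : Π → ℤ_l} Ker φ`" GIVEN `G ≅ Ẑ`, `Δ` pro-`Σ` and "`T_l(A)/G = 0`" for `X` ITSELF at the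
  primes `l ∈ Σ` only (no open subgroups, no Prop 2.2);
* `FundamentalExtension.preservesGeom_of_eq_iInf_ker` — the USE of the characterization clause alone
  (both sides): every `φ : Π_E ⥲ Π_F` carries `Δ_E` onto `Δ_F` (abc-iut-L4-t4's `preservesGeom_of_thm26i`
  asks the whole predicate `Thm26i`; only its second conjunct is used);
* **`FundamentalExtension.preservesGeom_of_isFreeProcyclic_of_isProSet`** — "`Δ ⊆ Π` is group-theoretic"
  for two extensions with `Gᵢ ≅ Ẑ`, `Δᵢ` pro-`Σᵢ`, GIVEN ONLY "`T_l(Aᵢ)/Gᵢ = 0`" for `Xᵢ` itself at the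
  primes `l ∈ Σᵢ` — a strictly shorter input list than `preservesGeom_of_isFreeProcyclic` (no Prop 2.2,
  no open-subgroup family, primes of `Σᵢ` only);
* `FundamentalExtension.preservesGeom_of_isFreeProcyclic_of_isProSet_of_geomTFG` — the same conclusion
  from the full printed-shape (i) inputs of `thm26i_of_isFreeProcyclic_of_isProSet` on both sides (the
  literal pro-`Σ` form of `preservesGeom_of_isFreeProcyclic`), for bookkeeping against the DAG node.

HONEST FRAMING: [AbsTopI] is a refereed, undisputed paper; classical profinite group theory; the
Tate-module input ("`T_l(A)/G = 0`", GAP-LEDGER G-L4t4-1) and the pro-`Σ` construction datum remain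
explicit hypotheses (geometric in print); nothing here bears on [IUTchIII] Cor. 3.12; typed ≠ proved
elsewhere.
-/

noncomputable section

open Topology

namespace Literature.AnabelianGeometry.AbsoluteAnabelian

namespace FundamentalExtension

universe u

variable (E : FundamentalExtension.{u}) {F : FundamentalExtension.{u}}

/-! ### The (i)-shape bridge: invariant characters of `Δ ∩ H` for all primes from `l ∈ Σ` -/

/-- **Bridge, (i)-shape.**  For `Δ` pro-`Σ`, the hypothesis "for every open `H ⊆ Π` and EVERY prime
`l`, every `H`-invariant continuous character `Δ ∩ H → ℤ_l` is trivial" follows from the same hypothesis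
at the primes `l ∈ Σ`: for `l ∉ Σ` the open subgroup `Δ ∩ H` of `Δ` is pro-`Σ`
(`isProSet_geom_inf_of_isOpen`) and every continuous `Δ ∩ H → ℤ_l` is trivial
(`IsProSet.apply_padicInt_eq_one`). [cite: MochizukiAbsTopI2012, Thm 2.6 (i) p.21] -/
theorem invariantCharactersOpen_trivial_of_isProSet (S : Set ℕ) (hpro : IsProSet E.geom S)
    (hT : ∀ (H : Subgroup E.arith), IsOpen (H : Set E.arith) → ∀ (l : ℕ) [Fact l.Prime], l ∈ S →
      ∀ (ψ : ↥(E.geom ⊓ H) →ₜ* Multiplicative ℤ_[l]),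
      (∀ g ∈ H, ∀ (d d' : ↥(E.geom ⊓ H)), (d' : E.arith) = g * d * g⁻¹ → ψ d' = ψ d) →
        ∀ d, ψ d = 1)
    (H : Subgroup E.arith) (hH : IsOpen (H : Set E.arith)) (l : ℕ) [Fact l.Prime]
    (ψ : ↥(E.geom ⊓ H) →ₜ* Multiplicative ℤ_[l])
    (hψ : ∀ g ∈ H, ∀ (d d' : ↥(E.geom ⊓ H)), (d' : E.arith) = g * d * g⁻¹ → ψ d' = ψ d)
    (d : ↥(E.geom ⊓ H)) : ψ d = 1 := by
  by_cases hl : l ∈ S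
  · exact hT H hH l hl ψ hψ d
  · exact (E.isProSet_geom_inf_of_isOpen hpro H hH).apply_padicInt_eq_one hl ψ d

/-! ### Off `Σ`: the rank clauses with NO Tate-module input -/

/-- **"`δ¹_l(H) = δ¹_l(G_H)` for `l ∉ Σ`", every open `H ⊆ Π`**, for `Δ` pro-`Σ` — with NO
Tate-module hypothesis: every `H`-invariant (indeed every) continuous character `Δ ∩ H → ℤ_l`, `l ∉ Σ`,
is trivial, so abc-iut-L4-t4's `freeProlRank_eq_aug_map_of_invariantCharacters_trivial` applies.  (Proof
of Thm 2.6 (ii) p. 23 l. 19–20: "`δ¹_l(Π) = δ¹_l(G)` for `l ∉ Σ`"; the case `H = Π` is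
`freeProlRank_arith_eq_gal_of_isProSet`.) [cite: MochizukiAbsTopI2012, Thm 2.6 (ii) p.21] -/
theorem freeProlRank_eq_aug_map_of_isProSet (S : Set ℕ) (hpro : IsProSet E.geom S)
    (H : Subgroup E.arith) (hH : IsOpen (H : Set E.arith)) (l : ℕ) [Fact l.Prime] (hl : l ∉ S) :
    freeProlRank H l = freeProlRank (H.map E.aug.toMonoidHom) l :=
  E.freeProlRank_eq_aug_map_of_invariantCharacters_trivial H hH l
    fun ψ _ d => (E.isProSet_geom_inf_of_isOpen hpro H hH).apply_padicInt_eq_one hl ψ d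

/-- **"`δ¹_l(H) = 1` for `l ∉ Σ`", every open `H ⊆ Π`**, for `G ≅ Ẑ` (print: `k` an FF) and `Δ`
pro-`Σ` — with NO Tate-module hypothesis (abc-iut-L4-t4's `freeProlRank_open_eq_one_of_isFreeProcyclic`
with its character hypothesis discharged by pro-`Σ`-ness). [cite: MochizukiAbsTopI2012, Thm 2.6 (i) p.21] -/
theorem freeProlRank_open_eq_one_of_isFreeProcyclic_of_not_mem (hG : IsFreeProcyclic E.gal)
    (S : Set ℕ) (hpro : IsProSet E.geom S) (H : Subgroup E.arith) (hH : IsOpen (H : Set E.arith))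
    (l : ℕ) [Fact l.Prime] (hl : l ∉ S) : freeProlRank H l = 1 :=
  E.freeProlRank_open_eq_one_of_isFreeProcyclic hG H hH l
    fun ψ _ d => (E.isProSet_geom_inf_of_isOpen hpro H hH).apply_padicInt_eq_one hl ψ d

/-! ### The characterization clause "`Ker(Π ↠ G) = Ker(Π ↠ Π^{ab-t})`" from the printed inputs -/

/-- `⊤ ⊆ Π` is open. [folklore] -/
private theorem isOpen_top : IsOpen ((⊤ : Subgroup E.arith) : Set E.arith) := by
  rw [Subgroup.coe_top]
  exact isOpen_univ

/-- **Thm 2.6 (i), characterization clause, printed input shape**: GIVEN `G ≅ Ẑ`, `Δ` pro-`Σ`, and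
"`T_l(A)/G = 0`" for `X` ITSELF at the primes `l ∈ Σ` (every `Π`-invariant continuous character
`Δ → ℤ_l`, `l ∈ Σ`, is trivial), `Δ` is the common kernel of the continuous `Π → ℤ_l` (all `l`).  For
`l ∉ Σ` every continuous `Π → ℤ_l` kills the pro-`Σ` group `Δ` outright.  No Prop 2.2 and no open
subgroups are needed for this clause. [cite: MochizukiAbsTopI2012, Thm 2.6 (i) p.21] -/
theorem geom_eq_iInf_ker_of_isFreeProcyclic_of_isProSet (hG : IsFreeProcyclic E.gal) (S : Set ℕ)
    (hpro : IsProSet E.geom S)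
    (hT : ∀ (l : ℕ) [Fact l.Prime], l ∈ S → ∀ (ψ : ↥(E.geom ⊓ ⊤) →ₜ* Multiplicative ℤ_[l]),
      (∀ g ∈ (⊤ : Subgroup E.arith), ∀ (d d' : ↥(E.geom ⊓ ⊤)),
        (d' : E.arith) = g * d * g⁻¹ → ψ d' = ψ d) → ∀ d, ψ d = 1) :
    E.geom = ⨅ (l : ℕ) (_ : Fact l.Prime) (φ : E.arith →ₜ* Multiplicative ℤ_[l]),
      φ.toMonoidHom.ker := by
  refine E.geom_eq_iInf_ker_of_isFreeProcyclic hG fun l _ ψ hψ d => ?_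
  by_cases hl : l ∈ S
  · exact hT l hl ψ hψ d
  · exact (E.isProSet_geom_inf_of_isOpen hpro ⊤ E.isOpen_top).apply_padicInt_eq_one hl ψ d

variable {E}

/-- **USE of the characterization clause alone**: if `Δ_E` and `Δ_F` are both the common kernels of the
continuous characters `Π → ℤ_l` (the second conjunct of the typed `Thm26i`, nothing else), every
isomorphism of topological groups `φ : Π_E ⥲ Π_F` carries `Δ_E` onto `Δ_F` — abc-iut-L4-t4's
`geom_map_le_of_eq_iInf_ker` in both directions. [cite: MochizukiAbsTopI2012, Thm 2.6 (i) p.21] -/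
theorem preservesGeom_of_eq_iInf_ker
    (hE : E.geom = ⨅ (l : ℕ) (_ : Fact l.Prime) (ψ : E.arith →ₜ* Multiplicative ℤ_[l]),
      ψ.toMonoidHom.ker)
    (hF : F.geom = ⨅ (l : ℕ) (_ : Fact l.Prime) (ψ : F.arith →ₜ* Multiplicative ℤ_[l]),
      ψ.toMonoidHom.ker)
    (φ : E.arith ≃ₜ* F.arith) : PreservesGeom φ := by
  refine le_antisymm
    (geom_map_le_of_eq_iInf_ker (fun l _ ψ => geom_le_ker_of_eq_iInf_ker hE l ψ) hF φ) ?_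
  -- `Δ_F = φ(φ⁻¹(Δ_F)) ⊆ φ(Δ_E)`
  have h1 : F.geom.map φ.symm.toMulEquiv.toMonoidHom ≤ E.geom :=
    geom_map_le_of_eq_iInf_ker (fun l _ ψ => geom_le_ker_of_eq_iInf_ker hF l ψ) hE φ.symm
  have h2 : (F.geom.map φ.symm.toMulEquiv.toMonoidHom).map φ.toMulEquiv.toMonoidHom = F.geom := by
    rw [Subgroup.map_map]
    have : φ.toMulEquiv.toMonoidHom.comp φ.symm.toMulEquiv.toMonoidHom = MonoidHom.id _ := by
      ext x
      exact φ.apply_symm_apply x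
    rw [this, Subgroup.map_id]
  calc F.geom = (F.geom.map φ.symm.toMulEquiv.toMonoidHom).map φ.toMulEquiv.toMonoidHom := h2.symm
    _ ≤ E.geom.map φ.toMulEquiv.toMonoidHom := Subgroup.map_mono h1

/-- **[AbsTopI] Thm 2.6 (i) ⟹ "`Δ ⊆ Π` is group-theoretic", printed input shape** (the sharp form):
for extensions `E`, `F` with `G_E, G_F ≅ Ẑ` (print: finite base fields), `Δ_E` pro-`Σ_E`, `Δ_F`
pro-`Σ_F`, GIVEN ONLY "`T_l(A)/G = 0`" for `X_E` at `l ∈ Σ_E` and for `X_F` at `l ∈ Σ_F` (invariant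
characters of `Δ` itself), every isomorphism `φ : Π_E ⥲ Π_F` carries `Δ_E` onto `Δ_F`.  Compared with
abc-iut-L4-t4's `preservesGeom_of_isFreeProcyclic`: no Prop 2.2, no family over open subgroups, primes
of `Σ` only. [cite: MochizukiAbsTopI2012, Thm 2.6 (i) p.21] -/
theorem preservesGeom_of_isFreeProcyclic_of_isProSet (hGE : IsFreeProcyclic E.gal)
    (hGF : IsFreeProcyclic F.gal) (S T : Set ℕ) (hproE : IsProSet E.geom S)
    (hproF : IsProSet F.geom T)
    (hTE : ∀ (l : ℕ) [Fact l.Prime], l ∈ S → ∀ (ψ : ↥(E.geom ⊓ ⊤) →ₜ* Multiplicative ℤ_[l]),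
      (∀ g ∈ (⊤ : Subgroup E.arith), ∀ (d d' : ↥(E.geom ⊓ ⊤)),
        (d' : E.arith) = g * d * g⁻¹ → ψ d' = ψ d) → ∀ d, ψ d = 1)
    (hTF : ∀ (l : ℕ) [Fact l.Prime], l ∈ T → ∀ (ψ : ↥(F.geom ⊓ ⊤) →ₜ* Multiplicative ℤ_[l]),
      (∀ g ∈ (⊤ : Subgroup F.arith), ∀ (d d' : ↥(F.geom ⊓ ⊤)),
        (d' : F.arith) = g * d * g⁻¹ → ψ d' = ψ d) → ∀ d, ψ d = 1)
    (φ : E.arith ≃ₜ* F.arith) : PreservesGeom φ :=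
  preservesGeom_of_eq_iInf_ker (E.geom_eq_iInf_ker_of_isFreeProcyclic_of_isProSet hGE S hproE hTE)
    (F.geom_eq_iInf_ker_of_isFreeProcyclic_of_isProSet hGF T hproF hTF) φ

/-- **The literal pro-`Σ` form of `preservesGeom_of_isFreeProcyclic`** (bookkeeping against the typed
predicate): for extensions `E`, `F` with `G_E, G_F ≅ Ẑ`, topologically finitely generated `Δ_E, Δ_F`
(Prop 2.2 BY NAME), `Δ_E` pro-`Σ_E`, `Δ_F` pro-`Σ_F`, and vanishing invariant characters of `Δ ∩ H` for
all open `H` at the primes of `Σ_E`, resp. `Σ_F` ("`T_l(A)/G = 0`" for the finite étale coverings,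
GAP-LEDGER G-L4t4-1), both sides satisfy `Thm26i` (`thm26i_of_isFreeProcyclic_of_isProSet`) and every
`φ : Π_E ⥲ Π_F` carries `Δ_E` onto `Δ_F`. [cite: MochizukiAbsTopI2012, Thm 2.6 (i) p.21] -/
theorem preservesGeom_of_isFreeProcyclic_of_isProSet_of_geomTFG (hGE : IsFreeProcyclic E.gal)
    (hGF : IsFreeProcyclic F.gal) (S T : Set ℕ) (hproE : IsProSet E.geom S)
    (hproF : IsProSet F.geom T) (hΔE : E.GeomTFG) (hΔF : F.GeomTFG)
    (hTE : ∀ (H : Subgroup E.arith), IsOpen (H : Set E.arith) → ∀ (l : ℕ) [Fact l.Prime], l ∈ S →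
      ∀ (ψ : ↥(E.geom ⊓ H) →ₜ* Multiplicative ℤ_[l]),
      (∀ g ∈ H, ∀ (d d' : ↥(E.geom ⊓ H)), (d' : E.arith) = g * d * g⁻¹ → ψ d' = ψ d) →
        ∀ d, ψ d = 1)
    (hTF : ∀ (H : Subgroup F.arith), IsOpen (H : Set F.arith) → ∀ (l : ℕ) [Fact l.Prime], l ∈ T →
      ∀ (ψ : ↥(F.geom ⊓ H) →ₜ* Multiplicative ℤ_[l]),
      (∀ g ∈ H, ∀ (d d' : ↥(F.geom ⊓ H)), (d' : F.arith) = g * d * g⁻¹ → ψ d' = ψ d) →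
        ∀ d, ψ d = 1)
    (φ : E.arith ≃ₜ* F.arith) : PreservesGeom φ :=
  preservesGeom_of_thm26i (E.thm26i_of_isFreeProcyclic_of_isProSet hGE S hproE hΔE hTE)
    (F.thm26i_of_isFreeProcyclic_of_isProSet hGF T hproF hΔF hTF) φ

end FundamentalExtension

end Literature.AnabelianGeometry.AbsoluteAnabelian

end
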